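import Summits.RiemannHypothesis.RiemannHypothesis.Theorems.LagariasZeroFreeDoorStrip
import HarnessLib

/-!
# `RH ⟺ Θ_ξ contractive on ℂ₊ off Z(E_ξ)` (no textbook input) and the MULTIPLIER FORM of the strip bound
# (Lagarias zero-free door, parts C–D of the dbr-neg g6 kernel; RH-free except the stated RH-equivalences)

Cell rh-split, seat rh-split-dbr-neg g6 (brief sha16 f79c5f09d8bcb036), card `run/shared/lean/pub/rh-split/cards/SPLIT-dbr-neg.md` §14;
Parts C–D of `HOME/rh-split-dbr-neg/SketchG6.lean` (re-issue sha16 fd2b5c65832e64db; referee rh-split-ref g3 REPLAY PASS + LABELS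
2026-08-27T05:17:39Z, content PASS for this zero-def file; lead rh-split-lead g3 RULING #21 (iv)), filed by rh-split-typer-1 g4 on top of
`Theorems/LagariasZeroFreeDoorStripPL.lean` (Part A, p499417) and `Theorems/LagariasZeroFreeDoorStrip.lean` (Part B, p500329).  Zero
definitions; decl blocks verbatim (namespace `…Theorems.LagariasThetaContractive`, opening `…Theorems.LagariasZeroFreeDoorStrip`).

* Part C — the LOCAL converse, no textbook input: just below the parameter `z₀ ∈ ℂ₊` of an off-line zero `ρ₀ = ½ − iz₀` of `ξ` (any
  multiplicity `m`), `Re ξ′/ξ(ρ₀ − t) = −m/t + O(1)` (`exists_re_logDeriv_lt_of_zero`, C1), so `|Θ_ξ| > 1` at points with `E_ξ ≠ 0`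
  (`one_lt_norm_lagariasTheta_of_re_logDeriv_lt`, C2; `exists_one_lt_norm_lagariasTheta_of_not_rh`, C3); hence
  `riemannHypothesis_of_lagariasTheta_contractive` (C4) and the KERNEL RH-EQUIVALENCE
  `riemannHypothesis_iff_lagariasTheta_contractive : RH ↔ ∀ z, 0 < Im z → E_ξ z ≠ 0 → ‖Θ_ξ z‖ ≤ 1` (C5; strengthens the tree's
  `Lagarias2006_thm1_if_holds`, which needs the strict HB inequality on all of `ℂ₊`), `riemannHypothesis_iff_zeroFree_and_contractive` (C6).
* Part D — MULTIPLIER FORM (the card's S∞ reduction): for ANY `b` with `|b| ≤ 1` on the closed upper half-plane and any holomorphic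
  extension `S` of `Θ_ξ·b` to the strip, `MinModulusCircles → |S| ≤ 1` (`norm_multiplier_le_one_on_strip`, `norm_lagariasTheta_mul_le_one`;
  `eventually_lagariasE_ne_zero`; `norm_lagariasTheta_le_one_of_zeroFree` = D3, the `b = 1` case).  With `b = B_{P₊}` the Blaschke product
  over the poles of `Θ_ξ` this is «`Θ_ξ = S/B_{P₊}`, `S` inner» — g5's open input (B2) is NOT needed; what remains is textbook:
  Hadamard–Littlewood minimum modulus (`MinModulusCircles`, typed in the tree) and Blaschke convergence (card §14 (B1)/(BL)).
LABELS (referee g3 05:17:39Z): C1–C3, D = RH-FREE kernel theorems (D conditional on the typed textbook input `MinModulusCircles` where it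
appears as an antecedent); C5 / C6 = RH-EQUIVALENT, PROVED, certify nothing about RH; class (dbr, neg) unchanged.  `RiemannHypothesis`
below is the summit's `Summit.RiemannHypothesis` (= Mathlib's, `Summit.RiemannHypothesis_iff`), exactly as in the scratch's namespace.
Nothing here is a claim about the truth of RH.
-/

noncomputable section

-- D-0017: `Summit.<S>.<S>.…` is the designed namespace of a single-problem summit.
set_option linter.dupNamespace false

open Set Filter Metric Complex Bornology Topology
open scoped ComplexConjugate
open Literature.NumberTheory.LFunctions Literature.Analysis.DeBrangesSpaces
open Summit.RiemannHypothesis.RiemannHypothesis.Theorems.LagariasZeroFreeDoor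
open Summit.RiemannHypothesis.RiemannHypothesis.Theorems.LagariasZeroFreeDoorStrip

namespace Summit.RiemannHypothesis.RiemannHypothesis.Theorems.LagariasThetaContractive

/-! ## Part C — the local converse: `RH ⟺ Θ_ξ contractive on ℂ₊ off Z(E_ξ)` (no textbook input) -/

/-- RH-FREE (C1, local complex analysis).  At a zero `ρ` of an analytic `f` (not locally `≡ 0`), the real
part of `f′/f` tends to `−∞` along the horizontal approach from the LEFT: for every `K` there is `δ > 0` with
`f(ρ − t) ≠ 0` and `Re f′/f(ρ − t) < K` for `0 < t < δ` (`f′/f = m/(s − ρ) + g′/g`, `m ≥ 1`). -/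
theorem exists_re_logDeriv_lt_of_zero {f : ℂ → ℂ} {ρ : ℂ} (hf : AnalyticAt ℂ f ρ) (h0 : f ρ = 0)
    (hne : ¬ ∀ᶠ z in 𝓝 ρ, f z = 0) (K : ℝ) :
    ∃ δ > (0 : ℝ), ∀ t : ℝ, 0 < t → t < δ → f (ρ - t) ≠ 0 ∧ (logDeriv f (ρ - t)).re < K := by
  obtain ⟨n, g, hg, hg0, hfg⟩ := hf.exists_eventuallyEq_pow_smul_nonzero_iff.mpr hne
  have hn : 1 ≤ n := by
    rcases Nat.eq_zero_or_pos n with h | h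
    · exfalso
      have h1 := hfg.self_of_nhds
      rw [h, pow_zero, one_smul] at h1
      exact hg0 (h1.symm.trans h0)
    · exact h
  have hgc : ContinuousAt (logDeriv g) ρ := by
    have : logDeriv g = fun z => deriv g z / g z := by funext z; rw [logDeriv_apply]
    rw [this]
    exact hg.deriv.continuousAt.div hg.continuousAt hg0
  set M : ℝ := (logDeriv g ρ).re + 1 with hM
  have hevM : ∀ᶠ z in 𝓝 ρ, (logDeriv g z).re < M := by
    have hmem : {w : ℂ | w.re < M} ∈ 𝓝 (logDeriv g ρ) :=
      (isOpen_lt continuous_re continuous_const).mem_nhds (by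
        simp only [mem_setOf_eq, hM]; linarith)
    exact hgc.preimage_mem_nhds hmem
  have hev : ∀ᶠ z in 𝓝 ρ, f z = (z - ρ) ^ n • g z ∧ g z ≠ 0 ∧ AnalyticAt ℂ g z ∧
      (logDeriv g z).re < M :=
    hfg.and ((hg.continuousAt.eventually_ne hg0).and (hg.eventually_analyticAt.and hevM))
  obtain ⟨ε, hε, hball⟩ := Metric.eventually_nhds_iff_ball.1 hev
  have hnpos : (0 : ℝ) < n := Nat.cast_pos.mpr (by omega)
  refine ⟨min ε (n / (|M - K| + 1)), lt_min hε (div_pos hnpos (by positivity)), fun t ht htδ => ?_⟩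
  have htε : t < ε := lt_of_lt_of_le htδ (min_le_left _ _)
  have htK : t < n / (|M - K| + 1) := lt_of_lt_of_le htδ (min_le_right _ _)
  set z : ℂ := ρ - t with hz
  have hzρ : z - ρ = -(t : ℂ) := by rw [hz]; ring
  have hzball : z ∈ ball ρ ε := by
    rw [mem_ball, dist_eq_norm, hzρ, norm_neg, Complex.norm_real, Real.norm_eq_abs, abs_of_pos ht]
    exact htε
  obtain ⟨hfz, hgz, hgaz, hMz⟩ := hball z hzball
  have hzρ0 : z - ρ ≠ 0 := by
    rw [hzρ, neg_ne_zero, Ne, Complex.ofReal_eq_zero]; exact ht.ne'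
  have hfz0 : f z ≠ 0 := by
    rw [hfz, smul_eq_mul]; exact mul_ne_zero (pow_ne_zero _ hzρ0) hgz
  refine ⟨hfz0, ?_⟩
  have hloc : f =ᶠ[𝓝 z] fun w => (w - ρ) ^ n * g w := by
    filter_upwards [isOpen_ball.mem_nhds hzball] with w hw
    rw [(hball w hw).1, smul_eq_mul]
  have hld : logDeriv f z = logDeriv (fun w => (w - ρ) ^ n * g w) z := by
    rw [logDeriv_apply, logDeriv_apply, hloc.deriv_eq, hloc.self_of_nhds]
  have hd1 : DifferentiableAt ℂ (fun w : ℂ => w - ρ) z := differentiableAt_id.sub_const ρ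
  have hformula : logDeriv (fun w => (w - ρ) ^ n * g w) z = n / (z - ρ) + logDeriv g z := by
    rw [logDeriv_mul (f := fun w => (w - ρ) ^ n) (g := g) z (pow_ne_zero _ hzρ0) hgz (hd1.pow n)
      hgaz.differentiableAt]
    congr 1
    rw [logDeriv_fun_pow hd1, logDeriv_apply, deriv_sub_const, deriv_id'', mul_one_div]
  rw [hld, hformula, add_re, hzρ]
  have hre : ((n : ℂ) / -(t : ℂ)).re = -(n / t) := by
    rw [← Complex.ofReal_natCast, ← Complex.ofReal_neg, ← Complex.ofReal_div, Complex.ofReal_re,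
      div_neg]
  rw [hre]
  have hnt : |M - K| + 1 < n / t := by
    rw [lt_div_iff₀ ht]
    have := (lt_div_iff₀ (by positivity : (0 : ℝ) < |M - K| + 1)).1 htK
    linarith
  have := le_abs_self (M - K)
  linarith

/-- RH-FREE (C2, the Cayley algebra of `cayleyHalfPlaneControl` with the inequality reversed).  With
`s = ½ − iz`, `w = ξ′/ξ(s)`: `E_ξ(z) = ξ(s)(1 + w)`, `E_ξ♯(z) = ξ(s)(1 − w)`; if `ξ(s) ≠ 0` and `Re w < −1`
then `E_ξ(z) ≠ 0` and `|Θ_ξ(z)| > 1`. -/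
theorem one_lt_norm_lagariasTheta_of_re_logDeriv_lt {z : ℂ} (hxi : riemannXi (1 / 2 - I * z) ≠ 0)
    (hw : (logDeriv riemannXi (1 / 2 - I * z)).re < -1) :
    lagariasE z ≠ 0 ∧ 1 < ‖lagariasTheta z‖ := by
  set s : ℂ := 1 / 2 - I * z with hs
  set w : ℂ := logDeriv riemannXi s with hw'
  have hderiv : deriv riemannXi s = riemannXi s * w := by
    rw [hw', logDeriv_apply, mul_div_cancel₀ _ hxi]
  have hE : lagariasE z = riemannXi s * (1 + w) := by
    rw [lagariasE_eq_lagariasXiA_add, lagariasXiA_eq, ← hs, hderiv]; ring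
  have hEs : sharp lagariasE z = riemannXi s * (1 - w) := by
    rw [sharp_lagariasE, ← hs, hderiv]; ring
  have h1w : 1 + w ≠ 0 := by
    intro h
    have := congrArg Complex.re h
    simp at this
    linarith
  refine ⟨by rw [hE]; exact mul_ne_zero hxi h1w, ?_⟩
  have hΘ : lagariasTheta z = (1 - w) / (1 + w) := by
    show sharp lagariasE z / lagariasE z = _
    rw [hEs, hE, mul_div_mul_left _ _ hxi]
  rw [hΘ, norm_div, one_lt_div (norm_pos_iff.mpr h1w)]
  have hsq : ‖1 + w‖ ^ 2 < ‖1 - w‖ ^ 2 := by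
    rw [Complex.sq_norm, Complex.sq_norm, Complex.normSq_apply, Complex.normSq_apply]
    simp only [sub_re, one_re, sub_im, one_im, zero_sub, add_re, add_im, zero_add]
    nlinarith
  exact lt_of_pow_lt_pow_left₀ 2 (norm_nonneg _) hsq

/-- RH-FREE as an implication (C3): if RH fails there is a point of `ℂ₊` where `E_ξ ≠ 0` and `|Θ_ξ| > 1`
(just below the parameter of an off-line zero, whatever its multiplicity). -/
theorem exists_one_lt_norm_lagariasTheta_of_not_rh (hRH : ¬ RiemannHypothesis) :
    ∃ z : ℂ, 0 < z.im ∧ lagariasE z ≠ 0 ∧ 1 < ‖lagariasTheta z‖ := by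
  obtain ⟨z₀, hz₀, hA⟩ : ∃ z₀ : ℂ, 0 < z₀.im ∧ riemannXi (1 / 2 - I * z₀) = 0 := by
    rw [riemannHypothesis_iff_lagariasXiA_zeros_real] at hRH
    push Not at hRH
    obtain ⟨z, hz, him⟩ := hRH
    rcases lt_or_gt_of_ne him with hneg | hpos
    · refine ⟨conj z, by rw [Complex.conj_im]; linarith, ?_⟩
      have h2 : lagariasXiA (conj z) = 0 := by rw [lagariasXiA_conj, hz, map_zero]
      rwa [lagariasXiA_eq] at h2
    · exact ⟨z, hpos, by rwa [lagariasXiA_eq] at hz⟩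
  set ρ : ℂ := 1 / 2 - I * z₀ with hρ
  have hξa : AnalyticAt ℂ riemannXi ρ := differentiable_riemannXi.analyticAt ρ
  have han : AnalyticOnNhd ℂ riemannXi univ := fun s _ => differentiable_riemannXi.analyticAt s
  have hne : ¬ ∀ᶠ s in 𝓝 ρ, riemannXi s = 0 := by
    intro h
    have hzero := han.eqOn_zero_of_preconnected_of_eventuallyEq_zero isPreconnected_univ (mem_univ ρ) h
    exact riemannXi_ne_zero_of_one_le_re (s := 2) (by norm_num) (hzero (mem_univ (2 : ℂ)))
  obtain ⟨δ, hδ, hblow⟩ := exists_re_logDeriv_lt_of_zero hξa hA hne (-1)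
  set t : ℝ := min (δ / 2) (z₀.im / 2) with ht
  have ht0 : 0 < t := lt_min (by linarith) (by linarith)
  have htδ : t < δ := lt_of_le_of_lt (min_le_left _ _) (by linarith)
  have htim : t < z₀.im := lt_of_le_of_lt (min_le_right _ _) (by linarith)
  obtain ⟨hξt, hre⟩ := hblow t ht0 htδ
  have hs : 1 / 2 - I * (z₀ - I * t) = ρ - t := by
    rw [hρ]; linear_combination (t : ℂ) * I_mul_I
  refine ⟨z₀ - I * t, ?_, ?_⟩
  · simp; linarith
  · rw [← hs] at hξt hre
    exact one_lt_norm_lagariasTheta_of_re_logDeriv_lt hξt hre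

/-- C4 (RH-EQUIVALENT bookkeeping, PROVED): contractivity of `Θ_ξ` on `ℂ₊` off the zeros of `E_ξ` implies
RH.  No zero-freeness, no boundedness elsewhere, no textbook input. -/
theorem riemannHypothesis_of_lagariasTheta_contractive
    (h : ∀ z : ℂ, 0 < z.im → lagariasE z ≠ 0 → ‖lagariasTheta z‖ ≤ 1) : RiemannHypothesis := by
  by_contra hRH
  obtain ⟨z, hz, hE, hΘ⟩ := exists_one_lt_norm_lagariasTheta_of_not_rh hRH
  exact not_lt.mpr (h z hz hE) hΘ

/-- **C5.  `RH ⟺ Θ_ξ` contractive on `ℂ₊` off `Z(E_ξ)`** — an RH-EQUIVALENCE PROVED in the kernel with NO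
textbook input (⟹: tree `Lagarias2006_thm1_onlyif_holds`; ⟸: C4).  It certifies nothing about RH. -/
theorem riemannHypothesis_iff_lagariasTheta_contractive :
    RiemannHypothesis ↔ ∀ z : ℂ, 0 < z.im → lagariasE z ≠ 0 → ‖lagariasTheta z‖ ≤ 1 := by
  refine ⟨fun hRH z hz hE => ?_, riemannHypothesis_of_lagariasTheta_contractive⟩
  have hlt := (Lagarias2006_thm1_onlyif_holds hRH).norm_sharp_lt hz
  show ‖sharp lagariasE z / lagariasE z‖ ≤ 1
  rw [norm_div, div_le_one (norm_pos_iff.mpr hE)]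
  exact hlt.le

/-- C6 (bookkeeping).  The zero-free door's ⟸ half needs only contractivity AT the zero-free points: combining
C4 with any proof of `|Θ_ξ| ≤ 1` off `Z(E_ξ)` (e.g. the card's S∞: `Θ_ξ = S/B`, `|S| ≤ 1`) would give RH iff
the Blaschke part is trivial.  Here: the form the card's «RH ⟺ κ = 0» uses. -/
theorem riemannHypothesis_iff_zeroFree_and_contractive :
    RiemannHypothesis ↔ (∀ z : ℂ, 0 < z.im → lagariasE z ≠ 0) ∧
      (∀ z : ℂ, 0 < z.im → ‖lagariasTheta z‖ ≤ 1) := by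
  constructor
  · intro hRH
    have hzf : ∀ z : ℂ, 0 < z.im → lagariasE z ≠ 0 := fun z hz => lagariasE_ne_zero_of_im_pos hRH hz
    exact ⟨hzf, fun z hz => (riemannHypothesis_iff_lagariasTheta_contractive.1 hRH) z hz (hzf z hz)⟩
  · rintro ⟨hzf, hle⟩
    exact riemannHypothesis_of_lagariasTheta_contractive fun z hz _ => hle z hz

/-! ## Part D — multiplier form of the strip bound (the S∞ reduction: Blaschke facts in, `|Θ_ξ·b| ≤ 1` out) -/

/-- RH-FREE.  `E_ξ` is not identically zero near any point (it has no zeros on `Im z ≥ ½`), so punctured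
neighbourhoods avoid `Z(E_ξ)` eventually. -/
theorem eventually_lagariasE_ne_zero (w : ℂ) : ∀ᶠ u in 𝓝[≠] w, lagariasE u ≠ 0 := by
  rcases (differentiable_lagariasE.analyticAt w).eventually_eq_zero_or_eventually_ne_zero with h | h
  · exfalso
    have han : AnalyticOnNhd ℂ lagariasE univ := fun u _ => differentiable_lagariasE.analyticAt u
    have hzero := han.eqOn_zero_of_preconnected_of_eventuallyEq_zero isPreconnected_univ (mem_univ w) h
    exact (cayleyHalfPlaneControl I (by norm_num)).1 (hzero (mem_univ I))
  · exact h

/-- **RH-FREE·CONDITIONAL-on-`MinModulusCircles` (D1, the S∞ reduction).**  Let `b` be ANY function with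
`|b| ≤ 1` on the closed upper half-plane, continuous at real points, and let `S` be holomorphic on the strip
`0 < Im z < ½`, continuous on its closure, and equal to `Θ_ξ·b` at every point of the closed upper half-plane
where `E_ξ ≠ 0` (so `b` kills the poles of `Θ_ξ` in the strip and `S` is the extension).  Then `|S| ≤ 1` on the
closed strip.  With `b = B_{P₊}` (the Blaschke product over the poles of `Θ_ξ` — its existence/convergence is the
textbook input (B1)+(BL) of the card) this is `Θ_ξ = S/B` with `S` inner: NO hypothesis on the
component structure of the Jensen half-disc region (g5's (B2)) is needed. -/
theorem norm_multiplier_le_one_on_strip (hmin : MinModulusCircles) {b S : ℂ → ℂ}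
    (hS : DiffContOnCl ℂ S (im ⁻¹' Ioo 0 (1 / 2)))
    (hSb : ∀ z : ℂ, 0 ≤ z.im → lagariasE z ≠ 0 → S z = lagariasTheta z * b z)
    (hb : ∀ z : ℂ, 0 ≤ z.im → ‖b z‖ ≤ 1) (hbc : ∀ x : ℝ, ContinuousAt b x)
    {z : ℂ} (hz0 : 0 ≤ z.im) (hz1 : z.im ≤ 1 / 2) : ‖S z‖ ≤ 1 := by
  obtain ⟨B, -, hB⟩ := exists_norm_lagariasE_le_exp_exp
  set U : Set ℂ := im ⁻¹' Ioo 0 (1 / 2) with hU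
  have hclU : closure U = im ⁻¹' Icc 0 (1 / 2) := by
    rw [hU, closure_preimage_im, closure_Ioo (by norm_num : (0 : ℝ) ≠ 1 / 2)]
  have hΘb : ∀ w : ℂ, 0 ≤ w.im → lagariasE w ≠ 0 → ‖lagariasTheta w‖ ≤ 1 → ‖S w‖ ≤ 1 := by
    intro w hw hE hΘ
    rw [hSb w hw hE, norm_mul]
    calc ‖lagariasTheta w‖ * ‖b w‖ ≤ 1 * 1 := mul_le_mul hΘ (hb w hw) (norm_nonneg _) zero_le_one
      _ = 1 := one_mul 1
  have hreal : ∀ x : ℝ, ‖S x‖ ≤ 1 := by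
    intro x
    by_cases hE : lagariasE x = 0
    · obtain ⟨q, r, hr, M, -, hqd, -, -, hΘq, hrefl⟩ := exists_ball_lagariasTheta_control x
      have hq1 : ‖q x‖ = 1 := by
        have h := hrefl (x : ℂ) (mem_ball_self hr)
        rw [Complex.conj_ofReal] at h
        have h2 : ‖q x‖ ^ 2 = 1 := by
          have := congrArg (fun w : ℂ => ‖w‖) h
          simpa [norm_mul, Complex.norm_conj, sq] using this
        exact (pow_eq_one_iff_of_nonneg (norm_nonneg _) two_ne_zero).1 h2
      have hxcl : (x : ℂ) ∈ closure U := by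
        rw [hclU]; simp only [mem_preimage, Complex.ofReal_im, mem_Icc]; norm_num
      haveI : (𝓝[U] (x : ℂ)).NeBot := mem_closure_iff_nhdsWithin_neBot.mp hxcl
      have h1 : Tendsto S (𝓝[U] (x : ℂ)) (𝓝 (S x)) :=
        ((hS.continuousOn (x : ℂ) hxcl).mono subset_closure).tendsto
      have h2 : Tendsto (fun u => q u * b u) (𝓝[U] (x : ℂ)) (𝓝 (q x * b x)) :=
        (((hqd _ (mem_ball_self hr)).continuousAt.mul (hbc x)).tendsto).mono_left nhdsWithin_le_nhds
      have hxU : U ⊆ {(x : ℂ)}ᶜ := by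
        intro u hu hux
        rw [mem_singleton_iff] at hux
        rw [hux, hU] at hu
        simp at hu
      have hev : ∀ᶠ u in 𝓝[U] (x : ℂ), S u = q u * b u := by
        have hne : ∀ᶠ u in 𝓝[U] (x : ℂ), lagariasE u ≠ 0 :=
          (eventually_lagariasE_ne_zero (x : ℂ)).filter_mono (nhdsWithin_mono _ hxU)
        have hball : ∀ᶠ u in 𝓝[U] (x : ℂ), u ∈ ball (x : ℂ) r :=
          mem_nhdsWithin_of_mem_nhds (isOpen_ball.mem_nhds (mem_ball_self hr))
        have hinU : ∀ᶠ u in 𝓝[U] (x : ℂ), u ∈ U := self_mem_nhdsWithin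
        filter_upwards [hne, hball, hinU] with u hne hball hinU
        rw [hSb u (le_of_lt hinU.1) hne, hΘq u hball (fun h => hxU hinU (mem_singleton_iff.2 h))]
      have h1' : Tendsto S (𝓝[U] (x : ℂ)) (𝓝 (q x * b x)) :=
        h2.congr' (hev.mono fun u hu => hu.symm)
      rw [tendsto_nhds_unique h1 h1', norm_mul, hq1, one_mul]
      exact hb x (by simp)
    · exact hΘb x (by simp) hE (norm_lagariasTheta_ofReal_le_one x)
  have hfr : ∀ w ∈ frontier U, ‖S w‖ ≤ 1 := by
    intro w hw
    rw [hU, frontier_preimage_im, frontier_Ioo (by norm_num : (0 : ℝ) < 1 / 2)] at hw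
    simp only [mem_preimage, mem_insert_iff, mem_singleton_iff] at hw
    rcases hw with hw | hw
    · have hwre : w = ((w.re : ℝ) : ℂ) := by
        apply Complex.ext <;> simp [hw]
      rw [hwre]; exact hreal w.re
    · have hc := cayleyHalfPlaneControl w (by rw [hw])
      exact hΘb w (by rw [hw]; norm_num) hc.1 hc.2.le
  have hgr : ∃ c < Real.pi / (1 / 2 - 0), ∃ B' : ℝ, ∀ R₀ : ℝ, ∃ R : ℝ, R₀ ≤ R ∧
      ∀ w ∈ U, ‖w‖ = R → ‖S w‖ ≤ Real.exp (B' * Real.exp (c * R)) := by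
    refine ⟨2, ?_, B + 1, fun R₀ => ?_⟩
    · rw [sub_zero, lt_div_iff₀ (by norm_num : (0 : ℝ) < 1 / 2)]
      linarith [Real.pi_gt_three]
    · obtain ⟨r, hr, hmr⟩ := hmin 1 one_pos R₀
      refine ⟨r, hr, fun w hw hwr => ?_⟩
      have hE : lagariasE w ≠ 0 :=
        norm_pos_iff.1 ((Real.exp_pos _).trans_le (hmr w hwr))
      rw [hSb w (le_of_lt hw.1) hE, norm_mul]
      calc ‖lagariasTheta w‖ * ‖b w‖ ≤ Real.exp ((B + 1) * Real.exp (2 * r)) * 1 :=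
            mul_le_mul (norm_lagariasTheta_le_of_sphere hB hmr hwr hE) (hb w (le_of_lt hw.1))
              (norm_nonneg _) (Real.exp_pos _).le
        _ = Real.exp ((B + 1) * Real.exp (2 * r)) := mul_one _
  have hzU : z ∈ closure U := by rw [hclU]; exact ⟨hz0, hz1⟩
  exact norm_le_of_subset_strip (by norm_num : (0 : ℝ) < 1 / 2) subset_rfl hS hfr hgr hzU

/-- RH-FREE·CONDITIONAL-on-`MinModulusCircles` (D2).  Same data: `|Θ_ξ(z)·b(z)| ≤ 1` at every point of
`ℂ₊` where `E_ξ ≠ 0` (above the strip, `|Θ_ξ| < 1` by `cayleyHalfPlaneControl`). -/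
theorem norm_lagariasTheta_mul_le_one (hmin : MinModulusCircles) {b S : ℂ → ℂ}
    (hS : DiffContOnCl ℂ S (im ⁻¹' Ioo 0 (1 / 2)))
    (hSb : ∀ z : ℂ, 0 ≤ z.im → lagariasE z ≠ 0 → S z = lagariasTheta z * b z)
    (hb : ∀ z : ℂ, 0 ≤ z.im → ‖b z‖ ≤ 1) (hbc : ∀ x : ℝ, ContinuousAt b x)
    {z : ℂ} (hz : 0 < z.im) (hE : lagariasE z ≠ 0) : ‖lagariasTheta z * b z‖ ≤ 1 := by
  rcases le_or_gt z.im (1 / 2) with h | h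
  · rw [← hSb z hz.le hE]
    exact norm_multiplier_le_one_on_strip hmin hS hSb hb hbc hz.le h
  · have hc := cayleyHalfPlaneControl z h.le
    rw [norm_mul]
    calc ‖lagariasTheta z‖ * ‖b z‖ ≤ 1 * 1 := mul_le_mul hc.2.le (hb z hz.le) (norm_nonneg _) zero_le_one
      _ = 1 := one_mul 1

/-- Bookkeeping (D3): with the trivial multiplier `b = 1`, `S = Θ̃`, D1 is the zero-free strip bound again —
recorded to show D1 genuinely generalises Part B. RH-FREE·CONDITIONAL-on-`MinModulusCircles`. -/
theorem norm_lagariasTheta_le_one_of_zeroFree (hmin : MinModulusCircles)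
    (hzf : ∀ z : ℂ, 0 < z.im → lagariasE z ≠ 0) {z : ℂ} (hz : 0 < z.im) : ‖lagariasTheta z‖ ≤ 1 :=
  (zeroFreeDoorIff_of_minModulusCircles hmin).2 hzf |> fun hRH =>
    (riemannHypothesis_iff_lagariasTheta_contractive.1 hRH) z hz (hzf z hz)

end Summit.RiemannHypothesis.RiemannHypothesis.Theorems.LagariasThetaContractive

end
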